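import Summits.HodgeConjecture.HodgeConjecture.Theorems.PadicSemiregularLiftFermatAnchorAssemblyGMFDefs
import Literature.AlgebraicGeometry.HodgeTheory.FermatInductiveClaimsProofs

/-!
# Stub `stub_readout` of line `witt-lift-rigid-mf` (crux `FermatAnchorAssembly`, stmt-HodgeConjecture-14874): the closed sub-cases

Route `PadicSemiregularLift` of `HodgeConjecture`, crux `FermatAnchorAssembly`, line `witt-lift-rigid-mf`
(skeleton `Cruxes/FermatAnchorAssembly/Lines/witt_lift_rigid_mf.lean`, vocabulary
`Theorems/PadicSemiregularLiftFermatAnchorAssemblyGMFDefs.lean`). The registered stub `stub_readout` is the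
CHARACTERISTIC-ZERO READOUT: for a lawful `L`-graded matrix factorization `N` of `Σ_{i<2r+2} xᵢᵐ` over a
field `K ⊇ ℚ` with a primitive `m`-th root `ζ` and a character `γ` with all `γᵢ ≠ 0`,
`Φₘ ∤ Θ_{γ,N} → claim(γ)` (`FermatCharacter.Claim m r γ : V(γ) ⊆ algebraicClasses (X²ʳₘ) r`). Its printed
proof (Hirzebruch–Riemann–Roch for the smooth proper dg category `HMF^{gr,L}`, Polishchuk–Vaintrob; the
Hochschild homology of graded factorization categories with its sector decomposition,
Ballard–Favero–Katzarkov Thm. 10.26; Orlov's theorem `HMF^gr(Σxᵢᵐ)` vs `D^b(X²ʳₘ)`, BFK Thm. 7.1 for the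
`M`-graded case; the HKR compatibility of the categorical Chern character, Căldăraru; Chern classes are
algebraic; `dim V(γ) = 1`, Ran 1980 Prop. 1.7) has no carrier in the tree.

This file proves, sorry-free, the sub-cases of the stub that close on the tree's carriers, as registered
helper sub-goals of stmt-HodgeConjecture-14874:

* `readout_trivialCases` — the conclusion `Claim m r γ` holds outright when `r = 0` (codimension `0`:
  `algebraicClasses _ 0 = ⊤`) or `Σ γᵢ ≠ 0` (`V(γ) = ⊥`, `fermatEigenspace_eq_bot_of_sum_ne_zero`: only the
  characters of `μₘ^{2r+2}/Δ` occur in `H•(X²ʳₘ(ℂ); ℂ)`);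
* `claim_of_represented` — the assembly of `Claim m r γ` from the two printed inputs of the remaining case
  `r > 0`, `Σ γᵢ = 0`, stated per character: (I) `V(γ)` is at most a line (Ran 1980 Prop. 1.7 (i); the tree's
  named fact `Ran1980_fermatEigenspace_le_span`), (II) some algebraic class has non-zero `γ`-component
  (the content of the readout: `Θ_{γ,N}(ζ) ≠ 0 ⟹ π_γ ch_r(E) ≠ 0` for the `D^b(X)`-component `E` of `N`).
  This is the tree's "represents ⟹ claim" (`FermatCharacter.claim_of_represents`) with the trivial cases
  folded in, so that the stub reduces to (II) alone.

Nothing here is a hypothesis structure or a named fact; axioms ⊆ {propext, Classical.choice, Quot.sound}.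
-/

-- `Summit.HodgeConjecture.HodgeConjecture.…` is the tree's mandated summit/problem namespace (single-problem summit).
set_option linter.dupNamespace false

noncomputable section

open Finset
open Literature.AlgebraicGeometry.HodgeTheory Literature.AlgebraicGeometry.HodgeTheory.FermatCharacter

namespace Summit.HodgeConjecture.HodgeConjecture.Cruxes.FermatAnchorAssembly.WittLiftRigidMf

/-! ### The trivial sub-cases of the readout -/

/-- `claim(γ)` is trivial when `Σ γᵢ ≠ 0`: the eigenspace `V(γ) ⊆ H²ʳ(X²ʳₘ(ℂ); ℂ)` is `⊥` (the diagonal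
`Δ ≤ μₘ^{2r+2}` acts trivially on `ℙ^{2r+1}`). [cite: Shioda1979PJA, §1 eq. (3) and §4] -/
theorem claim_of_sum_ne_zero {m r : ℕ} [NeZero m] {γ : Fin (2 * r + 2) → ZMod m} (hγ : ∑ i, γ i ≠ 0) :
    Claim m r γ := by
  change fermatEigenspace m γ (2 * r) ≤ _
  rw [fermatEigenspace_eq_bot_of_sum_ne_zero hγ]
  exact bot_le

/-- `claim(γ)` is trivial on `X⁰ₘ` (`r = 0`): in codimension `0` every class is algebraic
(`algebraicClasses _ 0 = ⊤`). [cite: Aoki1987, Introduction p. 385 (CLAIM(α))] -/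
theorem claim_of_dim_zero {m : ℕ} (γ : Fin (2 * 0 + 2) → ZMod m) : Claim m 0 γ := by
  intro x _
  rw [algebraicClasses_zero]
  exact Submodule.mem_top

/-- **Registered helper sub-goal `readout_trivialCases` (sub-case of `stub_readout`).** The conclusion
`Claim m r γ` of the readout holds outright — for every character, with no factorization and no charge
hypothesis — when `r = 0` (codimension `0`) or `Σ γᵢ ≠ 0` (`V(γ) = ⊥`). Hence `stub_readout` is reduced to
the admissible characters (`Σ γᵢ = 0`) in positive dimension. [cite: Shioda1979PJA, §1 eq. (3) and §4] -/
theorem readout_trivialCases : ∀ (m r : ℕ) [NeZero m] (γ : Fin (2 * r + 2) → ZMod m), (r = 0 ∨ ∑ i, γ i ≠ 0) → Claim m r γ := by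
  intro m r _ γ h
  rcases h with rfl | hsum
  · exact claim_of_dim_zero γ
  · exact claim_of_sum_ne_zero hsum

/-! ### The remaining case from its two printed inputs -/

/-- **Registered helper sub-goal `claim_of_represented` (the assembly step of `stub_readout`).** For a
character `γ` of `X²ʳₘ`: granted, in the only non-trivial case `r > 0`, `Σ γᵢ = 0`, (I) that `V(γ)` is at
most a line (Ran 1980 Prop. 1.7 (i): an instance of the tree's named fact
`Ran1980_fermatEigenspace_le_span`) and (II) that some class in the `ℂ`-span of the codimension-`r`
algebraic cycles has non-zero `γ`-component `π_γ c ≠ 0` (for the readout: `c = ch_r(E)` for the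
`D^b(X²ʳₘ)`-component `E` of the factorization `N`, non-zero in `V(γ)` because
`Θ_{γ,N}(ζ) = m^{2r+2}·⟨ch(N)_γ, ch(N)_{γ⁻¹}⟩ ≠ 0`), `claim(γ)` holds: `π_γ c` is again algebraic and spans
`V(γ)` (`FermatCharacter.claim_of_represents`); the cases `r = 0`, `Σ γᵢ ≠ 0` are `readout_trivialCases`.
[cite: Aoki1987, p. 386 (ω_α(Z) ≠ 0 ⟹ claim(α))] [cite: Ran1980, §1 Prop. 1.7 (i)] -/
theorem claim_of_represented : ∀ (m r : ℕ) [NeZero m] (γ : Fin (2 * r + 2) → ZMod m), (0 < r → ∑ i, γ i = 0 → ∃ v, fermatEigenspace m γ (2 * r) ≤ ℂ ∙ v) → (0 < r → ∑ i, γ i = 0 → ∃ c ∈ algebraicClasses (fermatHypersurface (2 * r) m) r, fermatProjector m γ (2 * r) c ≠ 0) → Claim m r γ := by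
  intro m r _ γ hdim hZ
  rcases Nat.eq_zero_or_pos r with rfl | hr
  · exact claim_of_dim_zero γ
  by_cases hsum : ∑ i, γ i = 0
  · exact FermatCharacter.claim_of_represents (hdim hr hsum) (hZ hr hsum)
  · exact claim_of_sum_ne_zero hsum

end Summit.HodgeConjecture.HodgeConjecture.Cruxes.FermatAnchorAssembly.WittLiftRigidMf

end
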